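import Mathlib
import HarnessLib
import Summits.CriticalPhenomena.CardyFormulaZ2.Theses.CardyIKTransport

/-!
# Line `sharp-seam-chimera` — checked skeleton for the crux `CardyIKTransport.CornerLineDescent`
# (stmt-CriticalPhenomena-10964, route `CardyIKTransport`, rank 3)

crux-plan unit `cruxplan-stmt-CriticalPhenomena-10964-sharp-seam-chimera` (planner, 2026-08-16), from
the crux idea card `Cruxes/CornerLineDescent/Ideas/sharp-seam-chimera.md` (ideator 2, round 1; triage
r1: pass / fail / pass-with-doubt) — line card `Lines/sharp-seam-chimera.md`.

THE CRUX (fixed, by name). `CornerLineDescent := H → CrudeBondCardy` with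
`H` = Cardy's formula for the crude crossing probabilities `P_IK` of the isotropic Izergin–Korepin
i.i.d.-bit gauge in every conformal rectangle (character for character `CardyDiluteOrbit.CardyIK`,
stmt-5913; `Disproof.lean` §A `cornerLineDescent_iff`, `Iff.rfl`) and `CrudeBondCardy` = Cardy for
bond-`ℤ²` at `p = ½`, crude event `embDomainCrossing` at the standard embedding, every conformal
rectangle.  Below, `CardyIKGauge` and `CrudeBondCardy` are these two statements and
`example : LineTarget ↔ (CardyIKGauge → CrudeBondCardy) := Iff.rfl` certifies the reading.

THE LINE (interpolate in SPACE, not in `t`).  In the route's gauge — column bits `A`, row bits `B`,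
Bernoulli(`2√3 − 3`) plaquette defects `D`, fair saddle coins; colour of the cell `v` =
`A_{v₀} ⊕ B_{v₁} ⊕` parity of the defects in the rectangle between `0` and `v` — keep the defects on
the faces `f` with `f₀ < S` and delete those with `S ≤ f₀`: the SHARP-SEAM CHIMERA `seamCrossingProb S`
(IK corner fugacity `√3/2` left of the vertical line `x = S`, corner fugacity `0` right of it, fair
coins everywhere; same black graph, same crude event).  Checked by hand (line card §Model): the face
parity of the chimera at the face `w` is `D(w)·[w₀ < S]`, its colour field is the uniform
antiderivative of these parities (axis colours i.i.d. fair, independent of `D`), and therefore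
* HOT EXIT, EXACT IN LAW: on the cells with `v₀ ≤ S` the chimera's (colour, coin) law is that of the
  pure IK gauge (strip parities right of any column are absorbed into the row bits `B`), so
  `seamCrossingProb S R δ = P_IK R δ` as soon as the seam is right of every cell of `R`;
* COLD EXIT, EXACT: on the cells with `S ≤ v₀` the colour is `A_{v₀} ⊕ B'_{v₁}` with `B'` i.i.d. fair
  and independent of `A` and of the coins — the PLAID gauge `plaidCrossingProb` (`t = 0`), which is
  bond percolation at `½` (the coins) on the renewal grid of the runs of `A` and `B'`, on the nose.
So the seam position `s ↦ seamAt s R δ := seamCrossingProb ⌊s/δ⌋ R δ` joins `P_IK R δ` (seam right of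
`R`) to the plaid gauge (seam left of `R`) INSIDE ONE exactly colour-symmetric, exactly self-dual model
at every mesh, through no intermediate corner fugacity and no `t → 0⁺` limit.

THE CUT (five registered stubs; composition `crux_of_stubStatements`, sorry-free, standard axioms;
`CornerLineDescent_of` plugs the stubs in and concludes the crux BY NAME):
* `stub_chimeraRSW`       S1 · box-crossing property of the chimera uniformly in the seam (a priori; L);
* `stub_hotEnd`           S2 · `RSW → H →` some interior seam near the right end of `R` is `ε`-close to
                            `P_IK` eventually (boundary-cap lemma; M);
* `stub_seamInvisibility` S3 · `RSW → H →` interior seams are interchangeable in the limit — THE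
                            load-bearing stub (line-defect irrelevance; XL, hardest);
* `stub_coldEnd`          S4 · `RSW →` some interior seam near the left end of `R` is `ε`-close to the
                            plaid gauge eventually (boundary-cap lemma; M);
* `stub_coldBridge`       S5 · Cardy for the plaid gauge in every conformal rectangle ⇒ `CrudeBondCardy`
                            (FreezeIdentification + renewal-grid homogenisation; M–L, no IK anywhere).
Glue (`plaidCardy_of`, proved): `H` gives `P_IK R → F(η_R)`; S2, S3, S4 move this value across `R` by
an `ε/4` argument to the plaid gauge; S5 carries it to the standard embedding.

DE-COSTUMING (triage r1-1 sharpen (1), r1-2 (a), r1-3 COSTUME note, acted on).  The ideator's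
`SeamInvisibility ∀ s s'` on `cellBox R δ` contained, by the exact exits, the instance "plaid on `R` vs
IK on `R` → 0" = the IK–bond `o(1)` bridge = the crux content (`Disproof.lean` §A
`cornerLineDescent_iff_ikBondBridge`).  Here S3 quantifies ONLY over interior seams (`SeamRange R s`:
`R` has points strictly on both sides of `re z = s`), where no exact exit applies, and the two ends are
separate stubs in the weak form "SOME interior seam is `ε`-close" — S3 alone does not give the bridge
(the limit profile could still jump at the ends), S2/S4 alone do not either; the bridge is exactly
S2 + S3 + S4, i.e. the composition.  No local per-column rate is registered (r1-1's `o(δ)` per step):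
in the infinite-volume gauge `seamCrossingProb (S+1) R δ` is `seamCrossingProb S (R − δ) δ` in law, so
a per-column statement is a domain-shift statement polluted by `O(δ)` boundary-discretisation noise
of the crude event, and one column step re-randomises the gluing along the whole seam (r1-2 (b),
r1-3 (a): `B ↦ B ⊕ C`) — the content is macroscopic and is stated macroscopically.

`Disproof.lean` (cdisprove cycle 1) honoured: §B — there is no `_false_without_H` theorem (the only
hypothesis `H` is "used by the mechanism"); this line uses `H` at S2 and S3 (and nowhere concludes
without it).  §C / landed `Theorems/CornerLineDescent/Negative/ModelBlindTransport.lean`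
(`cornerLineDescent_not_blind_transport`, `…_not_transport_under`): no stub has the refuted shape
`∀ P Q, Cardy P → (Symm Q →) Cardy Q` — S5 is a transport between two presentations of ONE model
(bond-`ℤ²` at `½`: plaid = bond on the renewal grid), S2–S4 are statements about one explicit coupled
family, and self-duality is never used to pin a value.  §D / landed `Negative/CornerFaceNoMonotone.lean`
(`cornerFace_negative_association`, `cornerFace_no_stochastic_order`): respected by construction — no
corner fugacity other than `0` and `√3/2` occurs, no monotone coupling in `t`, positive association is
available only in the coin fibre.  §F (M(t,½) = bond percolation of the coins on the saddle graph) is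
the language of S5 and of the RSW programme of S1.  §H(iii) (column differences uniform) is the cold
exit above.  `ledger negatives --problem CriticalPhenomena` (8 refuted; in this sub stmt-0748
degenerate arcs, stmt-6949 dual-current template): no stub restates one.
-/

noncomputable section

namespace Summit.CriticalPhenomena.CardyFormulaZ2.Cruxes.CornerLineDescent.SharpSeamChimera

open scoped BigOperators Topology Classical MeasureTheory ProbabilityTheory
open Filter Set MeasureTheory
open Literature.Probability.LatticeModels Literature.Probability.Percolation
open Literature.Probability.RandomPlanarGeometry

/-! ### The model: the route's i.i.d.-bit gauge with a sharp corner-fugacity seam -/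

/-- Sample space of the route's i.i.d.-bit gauge (verbatim the domain of `μ` in
`CardyIKTransport.CornerLineDescent`): column bits `A = ω.1`, row bits `B = ω.2.1`, IK plaquette
defects `D = ω.2.2.1` (Bernoulli `2√3 − 3`, i.e. corner fugacity `t = p/(1−p) = √3/2`), an unused fair
plaquette field `ω.2.2.2.1`, and the saddle coins `ω.2.2.2.2`. -/
abbrev GaugeSpace : Type :=
  Set ℤ × (Set ℤ × (Set (Site 2) × (Set (Site 2) × Set (Site 2))))

/-- The gauge law `μ` (verbatim the route's five-fold product). -/
def gaugeMeasure : Measure GaugeSpace :=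
  (sitePercolation ℤ half).prod ((sitePercolation ℤ half).prod
    ((sitePercolation (Site 2) (Set.projIcc (0:ℝ) 1 zero_le_one (2 * Real.sqrt 3 - 3))).prod
      ((sitePercolation (Site 2) half).prod (sitePercolation (Site 2) half))))

/-- Plaquette defects of the SHARP-SEAM CHIMERA with seam at column `S`: the IK defect field on the
faces `f` with `f 0 < S`, no defect (corner fugacity `t = 0`) on the faces with `S ≤ f 0`.  (The
route's `par` with the set of IK columns `(-∞, S)` and the complementary columns FROZEN instead of
fair.) -/
def seamPar (S : ℤ) (ω : GaugeSpace) (f : Site 2) : Prop :=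
  f 0 < S ∧ f ∈ ω.2.2.1

/-- Cell colour of the chimera (the route's `blk` with `par := seamPar S`): `A_{v₀} ⊕ B_{v₁} ⊕` parity
of the chimera's defects in the lattice rectangle between `0` and `v`.  Face parity at `w` =
`[w₀ < S] · D(w)`; law = uniform antiderivative of these parities (line card §Model). -/
def seamBlk (S : ℤ) (ω : GaugeSpace) (v : Site 2) : Prop :=
  Xor (v 0 ∈ ω.1) (Xor (v 1 ∈ ω.2.1)
    (Odd ((Finset.filter (fun f : ℤ × ℤ => seamPar S ω ![f.1, f.2])
      (Finset.Ico (min 0 (v 0)) (max 0 (v 0)) ×ˢ Finset.Ico (min 0 (v 1)) (max 0 (v 1)))).card)))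

/-- Cell colour of the PLAID gauge (`t = 0`, the seam at `−∞`): `A_{v₀} ⊕ B_{v₁}`, no defects.  Its
black clusters are EXACTLY the clusters of bond percolation at `½` (the coins at the checkerboard
corners) on the `45°` lattice of black blocks of the renewal product grid cut out by the runs of `A`
and `B` (i.i.d. geometric run lengths of mean `2`): the route's FreezeIdentification `M(0,½)`. -/
def plaidBlk (ω : GaugeSpace) (v : Site 2) : Prop :=
  Xor (v 0 ∈ ω.1) (v 1 ∈ ω.2.1)

/-- The saddle coin at the face `f` (fair on both sides of the seam; the route's `anti` at
`S = univ`, whose dead clause `f 0 ∉ univ` is dropped). -/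
def coinAnti (ω : GaugeSpace) (f : Site 2) : Prop :=
  f ∈ ω.2.2.2.2

/-- Black graph of a cell colouring `blk` (verbatim the route's `edges`): same-colour horizontal /
vertical neighbours, the NE diagonal of the face `u` unless its coin says anti, the SE diagonal when
the coin of the face below says anti (exactly one diagonal per face: a triangulation; Hex lemma and
colour-flip symmetry hold for every `blk` of the form above, seam or not). -/
def blackEdges (blk : GaugeSpace → Site 2 → Prop) (ω : GaugeSpace) : BondConfig (Site 2) :=
  {e | ∃ u v, e = s(u, v) ∧ blk ω u ∧ blk ω v ∧ (v = u + ![1, 0] ∨ v = u + ![0, 1] ∨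
    (v = u + ![1, 1] ∧ ¬ coinAnti ω u) ∨ (v = u + ![1, -1] ∧ coinAnti ω (u + ![0, -1])))}

/-- The cell embedding `v ↦ v₀ + i v₁` of the route's crude event. -/
def cellEmb (v : Site 2) : ℂ := ((v 0 : ℝ) : ℂ) + ((v 1 : ℝ) : ℂ) * Complex.I

/-- Crude crossing probability of the conformal rectangle `R` at mesh `δ` for the chimera with seam
at lattice column `S` (crude event `embDomainCrossing`: an open path of the black graph with all
cells in `R`, from within `2δ` of the arc `(ab) = R.arc 0` to within `2δ` of `(cd) = R.arc 2`, as in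
the crux). -/
def seamCrossingProb (S : ℤ) (R : ConformalRectangle) (δ : ℝ) : ℝ :=
  gaugeMeasure.real {ω | blackEdges (seamBlk S) ω ∈
    embDomainCrossing cellEmb R.carrier δ (R.arc 0) (R.arc 2)}

/-- The chimera with its seam at the MACROSCOPIC abscissa `s` (lattice column `⌊s/δ⌋`: the cells
with `δ v₀ < s` are hot, IK law; the cells with `δ v₀ ≥ s` are cold, plaid law). -/
def seamAt (s : ℝ) (R : ConformalRectangle) (δ : ℝ) : ℝ :=
  seamCrossingProb ⌊s / δ⌋ R δ

/-- Crude crossing probability of the plaid gauge (`t = 0`; the chimera with its seam left of every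
cell of `R` has exactly this value — cold exit). -/
def plaidCrossingProb (R : ConformalRectangle) (δ : ℝ) : ℝ :=
  gaugeMeasure.real {ω | blackEdges plaidBlk ω ∈
    embDomainCrossing cellEmb R.carrier δ (R.arc 0) (R.arc 2)}

/-- The route's `P_IK` — the `let P := …` of `CardyIKTransport.CornerLineDescent` character for
character (so that `LineTarget ↔ (CardyIKGauge → CrudeBondCardy)` is `Iff.rfl`): the crude crossing
probabilities of the isotropic Izergin–Korepin gauge.  The chimera with its seam right of every cell
of `R` has exactly this value (hot exit, in law). -/
def ikGaugeCrossingProb : ConformalRectangle → ℝ → ℝ :=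
  (fun R => let μ := (Literature.Probability.Percolation.sitePercolation ℤ Literature.Probability.Percolation.half).prod ((Literature.Probability.Percolation.sitePercolation ℤ Literature.Probability.Percolation.half).prod ((Literature.Probability.Percolation.sitePercolation (Literature.Probability.LatticeModels.Site 2) (Set.projIcc (0:ℝ) 1 zero_le_one (2 * Real.sqrt 3 - 3))).prod ((Literature.Probability.Percolation.sitePercolation (Literature.Probability.LatticeModels.Site 2) Literature.Probability.Percolation.half).prod (Literature.Probability.Percolation.sitePercolation (Literature.Probability.LatticeModels.Site 2) Literature.Probability.Percolation.half)))); let par : (Set ℤ × (Set ℤ × (Set (Literature.Probability.LatticeModels.Site 2) × (Set (Literature.Probability.LatticeModels.Site 2) × Set (Literature.Probability.LatticeModels.Site 2))))) → Literature.Probability.LatticeModels.Site 2 → Prop := fun ω f => (f 0 ∈ (Set.univ : Set ℤ) ∧ f ∈ ω.2.2.1) ∨ (f 0 ∉ (Set.univ : Set ℤ) ∧ f ∈ ω.2.2.2.1); let blk : (Set ℤ × (Set ℤ × (Set (Literature.Probability.LatticeModels.Site 2) × (Set (Literature.Probability.LatticeModels.Site 2) × Set (Literature.Probability.LatticeModels.Site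 2))))) → Literature.Probability.LatticeModels.Site 2 → Prop := fun ω v => Xor (v 0 ∈ ω.1) (Xor (v 1 ∈ ω.2.1) (Odd ((Finset.filter (fun f : ℤ × ℤ => par ω ![f.1, f.2]) (Finset.Ico (min 0 (v 0)) (max 0 (v 0)) ×ˢ Finset.Ico (min 0 (v 1)) (max 0 (v 1)))).card))); let anti : (Set ℤ × (Set ℤ × (Set (Literature.Probability.LatticeModels.Site 2) × (Set (Literature.Probability.LatticeModels.Site 2) × Set (Literature.Probability.LatticeModels.Site 2))))) → Literature.Probability.LatticeModels.Site 2 → Prop := fun ω f => f 0 ∉ (Set.univ : Set ℤ) ∨ f ∈ ω.2.2.2.2; let edges : (Set ℤ × (Set ℤ × (Set (Literature.Probability.LatticeModels.Site 2) × (Set (Literature.Probability.LatticeModels.Site 2) × Set (Literature.Probability.LatticeModels.Site 2))))) → Literature.Probability.Percolation.BondConfig (Literature.Probability.LatticeModels.Site 2) := fun ω => {e | ∃ u v, e = s(u, v) ∧ blk ω u ∧ blk ω v ∧ (v = u + ![1, 0] ∨ v = u + ![0, 1] ∨ (v = u + ![1, 1] ∧ ¬ anti ω u) ∨ (v = u +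 ![1, -1] ∧ anti ω (u + ![0, -1])))}; fun δ : ℝ => μ.real {ω | edges ω ∈ Literature.Probability.Percolation.embDomainCrossing (fun v : Literature.Probability.LatticeModels.Site 2 => ((v 0 : ℝ) : ℂ) + ((v 1 : ℝ) : ℂ) * Complex.I) R.carrier δ (R.arc 0) (R.arc 2)})

/-! ### Statements -/

/-- `H`, the antecedent of the crux: Cardy's formula for the IK gauge in every conformal rectangle
(character for character `CardyDiluteOrbit.CardyIK`, stmt-5913). -/
def CardyIKGauge : Prop :=
  ∀ R : ConformalRectangle, R.HasCrossingLimit (ikGaugeCrossingProb R) Literature.Probability.RandomPlanarGeometry.cardyFunction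

/-- The consequent of the crux, verbatim: Cardy's formula for bond percolation on `ℤ²` at `p = ½`,
crude embedded event at the standard embedding `√2·(v₀ + i v₁)`, in every conformal rectangle
(= the antecedent of the route's support item `CrudeToCanonical`, stmt-4968). -/
def CrudeBondCardy : Prop :=
  ∀ R : Literature.Probability.RandomPlanarGeometry.ConformalRectangle, R.HasCrossingLimit (fun δ ↦ (Literature.Probability.Percolation.bondPercolation (Literature.Probability.LatticeModels.zdGraph 2) Literature.Probability.Percolation.half).real (Literature.Probability.Percolation.embDomainCrossing Literature.Probability.LatticeModels.squareLatticeEmbedding.z R.carrier δ (R.arc 0) (R.arc 2))) Literature.Probability.RandomPlanarGeometry.cardyFunction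

/-- Cardy's formula for the PLAID gauge (crude event, cell embedding) in every conformal rectangle —
the value the seam argument delivers at the cold end. -/
def PlaidCardy : Prop :=
  ∀ R : ConformalRectangle, R.HasCrossingLimit (plaidCrossingProb R) Literature.Probability.RandomPlanarGeometry.cardyFunction

/-- `s` is an INTERIOR seam abscissa of `R`: the domain has points strictly left and strictly right
of the line `re z = s` (so the seam meets the connected open set `R.carrier`; the exact exits at
and beyond the two ends are excluded on purpose — de-costuming). -/
def SeamRange (R : ConformalRectangle) (s : ℝ) : Prop :=
  (∃ z ∈ R.carrier, z.re < s) ∧ ∃ w ∈ R.carrier, s < w.re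

/-- BOX-CROSSING PROPERTY OF THE CHIMERA, UNIFORMLY IN THE SEAM: for every integer aspect ratio `k`
there is `c_k > 0` such that for every seam column `S`, every `n ≥ 1` and every position, the
`kn × n` box is crossed horizontally and the `n × kn` box vertically by the black graph with
probability at least `c_k`.  The instances with the box left of the seam are the pure IK gauge
(= the `S = univ` member of the sibling crux `IKMixedBoxCrossing`, stmt-5911, in law), those with the
box right of it are the plaid gauge (bond-`ℤ²` at `½` on the renewal grid); the new part is the
straddling case. -/
def ChimeraRSW : Prop :=
  ∀ k : ℕ, 1 ≤ k → ∃ c : ℝ, 0 < c ∧ ∀ S : ℤ, ∀ n : ℕ, 1 ≤ n → ∀ a b : ℤ,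
    c ≤ gaugeMeasure.real {ω | blackEdges (seamBlk S) ω ∈
      openCrossing {v : Site 2 | a ≤ v 0 ∧ v 0 < a + k * n ∧ b ≤ v 1 ∧ v 1 < b + n}
        {v | v 0 = a ∧ b ≤ v 1 ∧ v 1 < b + n} {v | v 0 = a + k * n - 1 ∧ b ≤ v 1 ∧ v 1 < b + n}} ∧
    c ≤ gaugeMeasure.real {ω | blackEdges (seamBlk S) ω ∈
      openCrossing {v : Site 2 | a ≤ v 0 ∧ v 0 < a + n ∧ b ≤ v 1 ∧ v 1 < b + k * n}
        {v | v 1 = b ∧ a ≤ v 0 ∧ v 0 < a + n} {v | v 1 = b + k * n - 1 ∧ a ≤ v 0 ∧ v 0 < a + n}}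

/-- HOT END: for every conformal rectangle and every `ε > 0` some INTERIOR seam (necessarily close
to the right end of `R`) makes the chimera eventually `ε`-close to the pure IK gauge `P_IK`.
(Seams at or beyond `sup re R` give equality in law — the exact hot exit; the content is the
continuity of the seam profile at that end: a cold cap of macroscopic width `η` at the right extremity
of `R` changes the crossing probability by `o_η(1)`, uniformly in small `δ`.) -/
def HotEnd : Prop :=
  ∀ R : ConformalRectangle, ∀ ε : ℝ, 0 < ε → ∃ s : ℝ, SeamRange R s ∧
    ∀ᶠ δ in 𝓝[>] (0 : ℝ), |seamAt s R δ - ikGaugeCrossingProb R δ| ≤ ε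

/-- COLD END: for every conformal rectangle and every `ε > 0` some INTERIOR seam (close to the left
end of `R`) makes the chimera eventually `ε`-close to the plaid gauge.  (Seams at or beyond
`inf re R` give equality — the exact cold exit; the content is a hot cap of width `η` at the left
extremity costing `o_η(1)`.) -/
def ColdEnd : Prop :=
  ∀ R : ConformalRectangle, ∀ ε : ℝ, 0 < ε → ∃ s : ℝ, SeamRange R s ∧
    ∀ᶠ δ in 𝓝[>] (0 : ℝ), |seamAt s R δ - plaidCrossingProb R δ| ≤ ε

/-- SEAM INVISIBILITY INSIDE THE DOMAIN: for any two interior seam abscissae `s, s'` of `R` the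
chimera crossing probabilities differ by `o(1)` as `δ → 0⁺` (no limit is asserted to exist).  The one
new statement of the card: a colour-symmetric, exactly self-dual LINE DEFECT between two lattice
realisations of (conjecturally, and under `H` provably-on-one-side) the same universality class is
invisible at large scale. -/
def SeamInvisibility : Prop :=
  ∀ R : ConformalRectangle, ∀ s s' : ℝ, SeamRange R s → SeamRange R s' →
    Tendsto (fun δ => seamAt s R δ - seamAt s' R δ) (𝓝[>] (0 : ℝ)) (𝓝 0)

/-! ### Registered stubs (the only `sorry`s of this file) -/

/-- Registered stub `stub_chimeraRSW` (S1 · ChimeraRSW · a-priori input · size L).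
Box-crossing property of the sharp-seam chimera uniformly in the seam column, every integer aspect
ratio, both orientations (statement `ChimeraRSW`).  WHY PLAUSIBLY TRUE: every member is colour-flip
symmetric and satisfies the Hex lemma on the coin triangulation (black `kn × n` LR crossing ⇔ no
white TB crossing), so squares straddling nothing are crossed with probability exactly `½` at the two
pure ends (both are `D₄`-symmetric: IK by the measure-preserving bit bijection of `IKQuarterTurn`,
plaid trivially); the plaid end is bond-`ℤ²` at `½` on a renewal grid with geometric gaps, where
`rsw_half_holds` + grid distortion give everything; numerics (refuter ADDENDUM-g3 on stmt-5076; triage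
r1-3 T2) show IK and plaid `2:1` boxes at Cardy's `0.1756 ± 0.01` for `L ≤ 512`.  WHY IT MIGHT FAIL /
WHERE THE WORK IS: no FKG for colour events at the IK fugacity (`Negative/CornerFaceNoMonotone`:
`Cov = −(1−t)/(16(1+t)) < 0`), so squares do not glue into rectangles by Harris–FKG; positive
association holds only in the COIN FIBRE (given the colours, black connectivity is Bernoulli-`½` bond
percolation on the saddle graph, increasing in the black-bond bits — `Disproof.lean` §F, card
`saddle-graph-fibrewise-fkg`'s true first lemmas); the pure-IK instances are exactly the open sibling
crux r4 (`IKMixedBoxCrossing` with `S = univ`), shared, not re-solved here; the straddling case adds a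
gluing across the seam column (whose differences are i.i.d. fair for every fugacity, §H(iii)).
LEANS ON: `rsw_half_holds`, `BoxCrossing*.lean` (bond-`ℤ²`), `cellCrossing_duality_holds` (Hex lemma,
CellGridSaddlePercolationProofs), `IKMixedBoxCrossing` (stmt-5911), Tassion arXiv:1410.6773 /
Köhler-Schindler–Tassion (RSW from symmetry + weak association), GrimmettManolescu2014 (grid
distortion). -/
theorem stub_chimeraRSW : ChimeraRSW := by
  sorry

/-- Registered stub `stub_hotEnd` (S2 · HotEnd under RSW and `H` · size M).
`ChimeraRSW → CardyIKGauge → HotEnd`: given the box-crossing property and Cardy for the IK gauge, for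
every `R` and `ε > 0` there is an interior seam `s` (take `s = sup re R − η`, `η` small) with
`|seamAt s R δ − P_IK R δ| ≤ ε` for all small `δ`.  MECHANISM: (i) exact hot exit — for
`S ≥ 1 + max {v₀ : δ·v ∈ R}` the chimera's (colour, coin) law on the cells of `R` IS the IK gauge law
(the parities of the frozen strip are absorbed into the row bits), so `seamCrossingProb S R δ =
P_IK R δ`; (ii) the cap `{z ∈ R : re z > s}` has width `η`: compare the chimera on `R` with the IK
gauge on `R` through crossings of the sub-rectangle `R ∖ cap` (monotonicity of the crude event in the
domain, RSW arm bounds near the two marked points that the cap may contain, `H` + continuity of the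
conformal modulus under the cap perturbation for the IK side — `Literature/Analysis/Complex/
KernelConvergence.lean`, `cardyFunction` continuity — instead of an a-priori equicontinuity of IK
crossing probabilities).  WHY IT MIGHT FAIL: only through (ii)'s arm estimates across the seam
(three-arm / boundary two-arm bounds for the chimera near `∂R`), i.e. through S1-type input; the
statement itself is forced by any reasonable scaling picture.  `H` is USED here.
LEANS ON: S1, `H`, `embDomainCrossing` monotonicity (`isUpperSet_embDomainCrossing`, domain
inclusion), `MarkedDomain.exists_isUniformizing_holds`, `ConformalRectangle.crossRatio_eq_of_
isUniformizing_holds`, `BoxCrossingJordan.lean` (boundary arm control pattern for bond-`ℤ²`),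
GPS arXiv:1008.1378 §2 (continuity of crossing probabilities in the quad). -/
theorem stub_hotEnd : ChimeraRSW → CardyIKGauge → HotEnd := by
  sorry

/-- Registered stub `stub_seamInvisibility` (S3 · SeamInvisibility under RSW and `H` · THE
LOAD-BEARING STUB · size XL).  `ChimeraRSW → CardyIKGauge → SeamInvisibility`: for interior seams
`s, s'` of `R`, `seamAt s R δ − seamAt s' R δ → 0`.  Equivalently (given S1's equicontinuity): every
subsequential limit profile `s ↦ P(s; R)` is constant on the open abscissa range of `R` —
MACROSCOPIC invisibility of the IK | plaid line defect.  WHY PLAUSIBLY TRUE: both half-models are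
colour-symmetric, exactly self-dual (Hex lemma + flip, at every mesh, seam included) and
`D₄`-symmetric in the bulk with the same Beffara modulus `i`; under `H` the hot factor is conformally
invariant in the limit (Cardy ⇒ via S1 the full crossing/CLE₆ structure on the left is within reach),
the cold factor is bond-`ℤ²` on a renewal grid fed by the seam column; a duality-even, flip-even line
defect between two realisations of the percolation fixed point is RG-irrelevant (leading even line
operator: stress tensor `x = 2 > 1`; the duality-odd energy operator `x = 5/4` is removed by exact
self-duality — physical margin, not a proof); numerics: corner-line `2:1` boxes at `t = 1, 0.4, 0.25`
and the IK / bond ends all within `1.5σ` of Cardy (ADDENDUM-g3 on stmt-5076), chimera MC filed by the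
ideator (kit j008902/j008904: square across a mid seam → `½`?, `2:1` with mid seam vs the pure
bracket) is the cheapest falsifier.  WHY IT MIGHT FAIL: it is one-lattice universality in line-defect
form — no coupling makes a seam move cheap (one column step XORs a Bernoulli(`0.46`) parity walk into
the cold row bits, triage r1-2 (b) / r1-3 (a): unsigned cost `≈ δ⁻¹` dislocations `× δ^{1/4}`), so the
proof must be in law: either (A) from the LEFT with `H`: chimera crossing of a straddling quad =
⟨law of the IK seam-attachment sets of `(ab)`⟩ ⊗ ⟨independent renewal-bond kernel from seam runs to
`(cd)`⟩ (Schramm–Smirnov arXiv:1101.5820 Thm 1.5-type factorisation across a line, needs `α₄ > 1` on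
both sides), and show the glued kernel does not see `s`; or (B) the TRANSFER half-strip form
`⟨b| T_IK^m T_0^n |b'⟩` (both transfer matrices integrable at `q = e^{iπ/3}`: dilute `A₂⁽²⁾` at
`u = π/2`, Garbali–Nienhuis arXiv:1411.7020; dense `TL(1)`), `m ↔ n` exchange in the scaling regime —
the sibling routes' Perron/teleport technology (CardyCornerFugacity r2, CardyPerronTeleport).
HONOURS `Disproof.lean` §C: this IS the transport ("the transport is the entire content"); §B: uses `H`.
LEANS ON: S1, `H`, `cellCrossing_duality_holds`, `Garban2011_fourArm_multiscale_holds` (bond side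
`α₄ ≥ 1 + ε`), `QuadCrossingDiscreteGluingGarban.lean`, SchrammSmirnov2011 (arXiv:1101.5820),
GPS2013 (arXiv:1008.1378), OttVelenik2018 (arXiv:1706.09130, line defects, off-critical technology),
MorinduchesneKlumperPearce2023 (arXiv:2211.12379), GarbaliNienhuis (arXiv:1411.7020). -/
theorem stub_seamInvisibility : ChimeraRSW → CardyIKGauge → SeamInvisibility := by
  sorry

/-- Registered stub `stub_coldEnd` (S4 · ColdEnd under RSW · size M).
`ChimeraRSW → ColdEnd`: for every `R` and `ε > 0` there is an interior seam `s` (take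
`s = inf re R + η`) with `|seamAt s R δ − plaidCrossingProb R δ| ≤ ε` for all small `δ`.
MECHANISM: (i) exact cold exit — for `S ≤ min {v₀ : δ·v ∈ R}` the colours of the cells of `R` are
`A_{v₀} ⊕ B'_{v₁}` with `B' = B ⊕ (strip parities)` i.i.d. fair and independent of `A` and the coins,
so `seamCrossingProb S R δ = plaidCrossingProb R δ` on the nose; (ii) a hot cap of width `η` at the
left extremity costs `o_η(1)`: same comparison as S2 with the roles exchanged, the pure side now being
bond-`ℤ²` on the renewal grid, whose RSW / arm bounds / domain continuity are bond-`ℤ²` theorems of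
the tree up to grid distortion.  No `H` needed.  WHY IT MIGHT FAIL: only through the straddling arm
estimates of S1-type near the two marked points a cap may contain.
LEANS ON: S1, `rsw_half_holds`, `BoxCrossingJordan.lean` /
`discreteCrossingProb_clusterPt_mem_Ioo_holds` (bond-`ℤ²` crossing control in every conformal
rectangle), `isUpperSet_embDomainCrossing`, GrimmettManolescu2014 §2.2 (embedded crossing events under
grid distortion). -/
theorem stub_coldEnd : ChimeraRSW → ColdEnd := by
  sorry

/-- Registered stub `stub_coldBridge` (S5 · PlaidCardy → CrudeBondCardy · size M–L, no IK anywhere).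
Cardy's formula for the plaid gauge (crude event, cell embedding `v₀ + i v₁`, mesh `δ`) in EVERY
conformal rectangle implies Cardy's formula for bond-`ℤ²` at `½` (crude event, standard embedding
`√2 (v₀ + i v₁)`) in every conformal rectangle.  MECHANISM (FreezeIdentification + renewal
homogenisation, the route's TWO-LAYER PLAN for this crux, cut differently): (i) the plaid black
clusters are exactly the open clusters of the coins seen as Bernoulli-`½` bonds between diagonally
adjacent black blocks of the renewal product grid (runs of `A` × runs of `B`, black blocks = one
checkerboard class), i.e. bond percolation on `ℤ²` drawn on the `45°`-rotated random grid of block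
corners; (ii) SLLN for the i.i.d. geometric(`½`) run lengths: inside the window of `R` the grid is
`2δ·ℤ²` up to a random distortion `o(1)` in sup-norm, a.s.; (iii) bond-`ℤ²` crossing probabilities are
equicontinuous under `o(1)` perturbations of the conformal rectangle (RSW boundary arm control, tree
`BoxCrossingJordan.lean`), so plaid(`e^{iπ/4} R`, `δ`) `−` bond-std(`R`, `2δ`) `→ 0` (rotation by `45°`
and the factor `√2·2δ/(2√2 δ)` match the two lattices); (iv) the class of conformal rectangles and
the modulus are invariant under the similarity `z ↦ e^{iπ/4} z` (`HasCrossingLimit.of_image_data`,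
ImageUnivalent.lean), and `δ ↦ 2δ` is a reparametrisation of `𝓝[>] 0`.  Crude-event bookkeeping: blocks
have `O(log δ⁻¹)` cells in the window (macroscopically `o(1)`); the `2δ` endpoint slack is harmless on
the cell lattice (a cell every `δ`) — the product-grid hazard recorded on stmt-5077 concerned the
crude event drawn ON a sparse grid, which never occurs here.  WHY IT MIGHT FAIL: only bookkeeping
(rough Jordan boundaries: blocks meeting `∂R` partially; handled by the Bollobás–Riordan Ch. 7
sandwich pattern already used for `CrudeToCanonical`).  Not of the refuted model-blind shape
(`Negative/ModelBlindTransport`): both families are bond-`ℤ²` at `½`.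
LEANS ON: `rsw_half_holds`, `BoxCrossingJordan.lean`, `discreteCrossingProb_clusterPt_mem_Ioo_holds`,
`JordanDomain.exists_forall_mem_meshDomain_and_reachable`, `HasCrossingLimit.of_image_data`
(ImageUnivalent), `cardyFunction_one_sub` / `strictMonoOn_cardyFunction_holds`, Mathlib
`ProbabilityTheory.strong_law_ae`, route supports `RenewalGridHarmless` (stmt-4967, bounded-gap
variant) and `CrudeToCanonical` (stmt-4968) for the discretisation patterns, BollobasRiordan2006 Ch. 7,
GrimmettManolescu2014 §2.2. -/
theorem stub_coldBridge : PlaidCardy → CrudeBondCardy := by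
  sorry

/-! ### Composition (sorry-free, standard axioms) -/

/-- Local alias of the crux statement — the conclusion of the sorry-free implication
`crux_of_stubStatements` (so that exactly ONE theorem of this file, `CornerLineDescent_of`, concludes
the route decl itself by name, as the skeleton audit requires). -/
def LineTarget : Prop :=
  Summit.CriticalPhenomena.CardyFormulaZ2.Theses.CardyIKTransport.CornerLineDescent

/-- Reading of the crux certified by definitional unfolding: `CornerLineDescent` IS
`CardyIKGauge → CrudeBondCardy` (the route's `let P := …` ζ-reduces to `ikGaugeCrossingProb`). -/
example : LineTarget ↔ (CardyIKGauge → CrudeBondCardy) := Iff.rfl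

/-- **The `ε/4` lemma** (the glue of the line, PROVED): Cardy for the IK gauge, the two end lemmas
and seam invisibility inside `R` give Cardy's formula for the plaid gauge in every conformal
rectangle.  For a uniformizing datum `(φ, x)` of `R` with Cardy value `c = F(crossRatio x)`:
`|plaid − c| ≤ |plaid − ch s₂| + |ch s₂ − ch s₁| + |ch s₁ − P_IK| + |P_IK − c| < ε` eventually. -/
theorem plaidCardy_of (hH : CardyIKGauge) (hhot : HotEnd) (hcold : ColdEnd)
    (hseam : SeamInvisibility) : PlaidCardy := by
  intro R φ x hφx
  set c : ℝ := Literature.Probability.RandomPlanarGeometry.cardyFunction (crossRatio x) with hc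
  have hIK : Tendsto (ikGaugeCrossingProb R) (𝓝[>] (0 : ℝ)) (𝓝 c) := hH R φ x hφx
  rw [Metric.tendsto_nhds] at hIK ⊢
  intro ε hε
  have hε4 : 0 < ε / 4 := by positivity
  obtain ⟨s₁, hs₁, h₁⟩ := hhot R (ε / 4) hε4
  obtain ⟨s₂, hs₂, h₂⟩ := hcold R (ε / 4) hε4
  have h₃ := hseam R s₁ s₂ hs₁ hs₂
  rw [Metric.tendsto_nhds] at h₃
  filter_upwards [h₁, h₂, h₃ (ε / 4) hε4, hIK (ε / 4) hε4] with δ H₁ H₂ H₃ H₄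
  rw [Real.dist_eq] at H₃ H₄ ⊢
  rw [sub_zero] at H₃
  rw [abs_le] at H₁ H₂
  rw [abs_lt] at H₃ H₄ ⊢
  constructor <;> linarith [H₁.1, H₁.2, H₂.1, H₂.2, H₃.1, H₃.2, H₄.1, H₄.2]

/-- **The sorry-free implication**: the five stub STATEMENTS imply the crux (`LineTarget` is by
definition `CardyIKTransport.CornerLineDescent`).  `H` enters S2 and S3; S1 feeds S2–S4; S5 is last. -/
theorem crux_of_stubStatements :
    ChimeraRSW →
    (ChimeraRSW → CardyIKGauge → HotEnd) →
    (ChimeraRSW → CardyIKGauge → SeamInvisibility) →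
    (ChimeraRSW → ColdEnd) →
    (PlaidCardy → CrudeBondCardy) →
    LineTarget := by
  intro hrsw hhot hseam hcold hbridge hH
  exact hbridge (plaidCardy_of hH (hhot hrsw hH) (hcold hrsw) (hseam hrsw hH))

/-- **THE SKELETON THEOREM: the crux BY NAME from the five registered stubs** (sorries live only
inside `stub_*`; this declaration is itself sorry-free and becomes the crux proof when the stubs
land). -/
theorem CornerLineDescent_of :
    Summit.CriticalPhenomena.CardyFormulaZ2.Theses.CardyIKTransport.CornerLineDescent :=
  crux_of_stubStatements stub_chimeraRSW stub_hotEnd stub_seamInvisibility stub_coldEnd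
    stub_coldBridge

end Summit.CriticalPhenomena.CardyFormulaZ2.Cruxes.CornerLineDescent.SharpSeamChimera

end
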